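import Summits.HodgeConjecture.HodgeConjecture.Theses.CyclicUnitaryPowers
import Summits.HodgeConjecture.HodgeConjecture.Theorems.CyclicUnitaryPowersModelTransfer
import Literature.AlgebraicGeometry.HodgeTheory.DiagonalSymmetryStability
import Literature.AlgebraicGeometry.HodgeTheory.SymmetricHypersurfaceInvolution
import Literature.AlgebraicGeometry.HodgeTheory.FermatCurveJacobianCMType

/-!
# K1 deck-model clauses (o)–(ii) for the `p`-cyclic planes (route `CyclicUnitaryPowers`,
# item stmt-HodgeConjecture-19544)

Helper lemmas for the K1 line `unitary-reflection-zariski` (skeleton `63611234fe9f087b`) of crux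
`VeryGeneralDeckCommutatorsInHg` (rank 2), stub `stub_cyclicDeckModel`; landed
`--supports stmt-HodgeConjecture-19544` (it closes nothing). Prover seat `hodge-nonav-prover-A` (g0),
2026-08-27. Sorry-free, no definition, no named fact.

The registered stub `stub_cyclicDeckModel` is false at the degenerate member `f = 0` (companion file
`Theorems/VeryGeneralDeckCommutatorsInHg/Negative/CyclicDeckModelDegenerate`, `not_stub_cyclicDeckModel`),
and its repaired form (extra hypothesis `f ≠ 0`) has four clauses `Deck` (i)–(iv) about the CANONICAL deck
transformation `σ = diagonalAut F ha` of the model `X_F = SmoothHypersurface.hypersurface F`,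
`F = x₃^p − f(x₀,x₁,x₂)`, `a = (1,1,1,e^{2πi/p})`. This file proves the clauses that hold for EVERY
member and need no Hodge theory of the cyclic cover — the membership (o) and clauses (i), (ii):

* §1 from the group law of the canonical deck maps as `ℂ`-morphisms (the tree's `diagonalAut_mul`,
  `diagonalAut_one`; here `diagonalAut_congr`):
  **`(σ^*)^m = (g_{a^m})^*`** on `Hᵏ(X_F(ℂ); ℚ)` (`pull_diagonalAut_pow`), so **`(σ^*)^m = 1` whenever
  `a^m = 1`** (`pull_diagonalAut_pow_eq_one`) — any form `F`, any degree `k`;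
* §2 `rootUnits_pow_eq_one`: `(1,1,1,e^{2πi/p})^p = 1`;
* §3 `exists_cyclicDeckModel_clauses_one_two`: for every `p ≠ 0`, every ternary `f` and every
  `hXF : IsSmoothProjective 2 X_F`, the vector `a` stabilises `F` (the tree's
  `rootUnits_mem_diagonalStabilizer`) and `σ = diagonalAut F ha` satisfies `pull σ 2 ^ p = 1` and
  `tr hXF (2 + 2) (cup X_F 2 2 (pull σ 2 x) (pull σ 2 y)) = tr hXF (2 + 2) (cup X_F 2 2 x y)`
  — conjuncts (i), (ii) of `Deck p X_F hXF σ` VERBATIM (clause (ii) is the tree's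
  `tr_cup_pull_diagonalAut`: automorphisms fix the light trace).

Not here: (iii) `dim_ℚ H²(X_F)^{σ} = 1` and (iv) the eigen-Hodge numbers `ehn p j q` — Griffiths'
residue description WITH its Jacobian-ideal kernel for `x₃^p − f` (the tree has only the span form,
named fact `Griffiths1969_residues_span_hodgeFiltration`); brick B4 of the P3 plan.

## References

* [Hartshorne1977] R. Hartshorne, Algebraic Geometry, GTM 52 (1977), II Example 7.1.1, II Ex. 2.14.
* [Katz2009] N. M. Katz, Another look at the Dwork family, Progr. Math. 270 (2009), §3.
* [HatcherAT2002] A. Hatcher, Algebraic Topology, CUP 2002, §3.1 p. 198, §3.3 Thm. 3.26.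
-/

noncomputable section

namespace Summit.HodgeConjecture.HodgeConjecture.Theorems.CyclicUnitaryPowersDeckModelClauses

open Literature.AlgebraicGeometry.Motives Literature.AlgebraicGeometry.HodgeTheory
open Literature.AlgebraicGeometry.HodgeTheory.BettiUniverse
open Literature.AlgebraicTopology.SingularHomology
open CategoryTheory
open Summit.HodgeConjecture.HodgeConjecture.Theorems.CyclicUnitaryPowersModelTransfer
  (rootUnits_mem_diagonalStabilizer)

/-! ### §1 The canonical deck maps form a group of `ℂ`-automorphisms; powers of `σ^*` -/

section Group

variable {n : ℕ} (F : MvPolynomial (Fin (n + 2)) ℂ) {a b : Fin (n + 2) → ℂˣ}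

/-- `g_a` depends on the vector `a` only (proof irrelevance in the membership). [folklore] -/
theorem diagonalAut_congr (ha : a ∈ diagonalStabilizer F) (hb : b ∈ diagonalStabilizer F) (h : a = b) :
    diagonalAut F ha = diagonalAut F hb := by
  subst h
  rfl

/-- **`(g_a^*)^m = (g_{a^m})^*`** on `Hᵏ(X_F(ℂ); ℚ)`: `pull` is contravariantly multiplicative
(`pull_comp`, `pull_id`) and `a ↦ g_a` is a homomorphism over `ℂ` (the tree's `diagonalAut_mul`,
`diagonalAut_one`). [cite: HatcherAT2002, §3.1 p. 198] -/
theorem pull_diagonalAut_pow (ha : a ∈ diagonalStabilizer F) (k m : ℕ) :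
    pull (diagonalAut F ha) k ^ m = pull (diagonalAut F (pow_mem ha m)) k := by
  induction m with
  | zero =>
    rw [pow_zero, diagonalAut_congr F (pow_mem ha 0) (one_mem _) (pow_zero a), diagonalAut_one, pull_id]
    rfl
  | succ m ih =>
    rw [pow_succ, ih, diagonalAut_congr F (pow_mem ha (m + 1)) (mul_mem (pow_mem ha m) ha) (pow_succ a m),
      diagonalAut_mul, pull_comp]
    rfl

/-- **`(g_a^*)^m = 1` on `Hᵏ(X_F(ℂ); ℚ)` when `a^m = 1`** (clause (i) of `Deck` for a deck map of
order dividing `m`). [cite: HatcherAT2002, §3.1 p. 198] -/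
theorem pull_diagonalAut_pow_eq_one (ha : a ∈ diagonalStabilizer F) {m : ℕ} (h : a ^ m = 1) (k : ℕ) :
    pull (diagonalAut F ha) k ^ m = 1 := by
  rw [pull_diagonalAut_pow, diagonalAut_congr F (pow_mem ha m) (one_mem _) h, diagonalAut_one, pull_id]
  rfl

end Group

/-! ### §2 The unit vector `(1,1,1,e^{2πi/p})` has order dividing `p` -/

/-- **`(1,1,1,e^{2πi/p})^p = 1`** in `(ℂˣ)⁴` (`e^{2πi} = 1`). [folklore] -/
theorem rootUnits_pow_eq_one {p : ℕ} (hp : p ≠ 0) :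
    (fun i : Fin 4 => if i = Fin.last 3 then
        (Units.mk0 (Complex.exp (2 * (Real.pi : ℂ) * Complex.I / (p : ℂ))) (Complex.exp_ne_zero _))
      else 1) ^ p = 1 := by
  funext i
  rw [Pi.pow_apply, Pi.one_apply]
  split_ifs with hi
  · ext
    rw [Units.val_pow_eq_pow_val, Units.val_mk0, Units.val_one, ← Complex.exp_nat_mul,
      mul_div_cancel₀ _ (Nat.cast_ne_zero.2 hp), Complex.exp_two_pi_mul_I]
  · exact one_pow p

/-! ### §3 Clauses (o), (i), (ii) of the deck model, verbatim -/

/-- **Deck-model clauses (o)–(ii) for the `p`-cyclic planes**: for `p ≠ 0`, any ternary form `f`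
and any `hXF`, with `F = x₃^p − f(x₀,x₁,x₂)`, `X_F = SmoothHypersurface.hypersurface F`: the vector
`a = (1,1,1,e^{2πi/p})` lies in `diagonalStabilizer F`, and `σ = diagonalAut F ha` satisfies
(i) `pull σ 2 ^ p = 1` and (ii) `tr hXF (2 + 2) (cup X_F 2 2 (pull σ 2 x) (pull σ 2 y)) =
tr hXF (2 + 2) (cup X_F 2 2 x y)` — the first two conjuncts of the route's `Deck p X_F hXF σ`.
(Conjuncts (iii)–(iv) are not addressed here; they are false at `f = 0`.)
[cite: Katz2009, §3] [cite: HatcherAT2002, §3.3 Thm. 3.26 and §3.1 p. 198] -/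
theorem exists_cyclicDeckModel_clauses_one_two {p : ℕ} (hp : p ≠ 0) (f : MvPolynomial (Fin 3) ℂ)
    (hXF : IsSmoothProjective 2 (SmoothHypersurface.hypersurface
      (MvPolynomial.X (Fin.last 3) ^ p - MvPolynomial.rename Fin.castSucc f))) :
    ∃ ha : (fun i : Fin 4 => if i = Fin.last 3 then
        (Units.mk0 (Complex.exp (2 * (Real.pi : ℂ) * Complex.I / (p : ℂ))) (Complex.exp_ne_zero _))
      else 1) ∈ diagonalStabilizer (MvPolynomial.X (Fin.last 3) ^ p - MvPolynomial.rename Fin.castSucc f),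
      pull (diagonalAut (MvPolynomial.X (Fin.last 3) ^ p - MvPolynomial.rename Fin.castSucc f) ha) 2 ^ p
          = 1 ∧
        ∀ x y : bettiCohomology (SmoothHypersurface.hypersurface
            (MvPolynomial.X (Fin.last 3) ^ p - MvPolynomial.rename Fin.castSucc f)) 2,
          tr hXF (2 + 2) (cup (SmoothHypersurface.hypersurface
              (MvPolynomial.X (Fin.last 3) ^ p - MvPolynomial.rename Fin.castSucc f)) 2 2
            (pull (diagonalAut (MvPolynomial.X (Fin.last 3) ^ p - MvPolynomial.rename Fin.castSucc f) ha)
              2 x)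
            (pull (diagonalAut (MvPolynomial.X (Fin.last 3) ^ p - MvPolynomial.rename Fin.castSucc f) ha)
              2 y)) =
          tr hXF (2 + 2) (cup (SmoothHypersurface.hypersurface
              (MvPolynomial.X (Fin.last 3) ^ p - MvPolynomial.rename Fin.castSucc f)) 2 2 x y) :=
  ⟨rootUnits_mem_diagonalStabilizer hp f,
    pull_diagonalAut_pow_eq_one _ _ (rootUnits_pow_eq_one hp) 2,
    fun x y ↦ tr_cup_pull_diagonalAut (n := 2) _ hXF _ 2 2 x y⟩

end Summit.HodgeConjecture.HodgeConjecture.Theorems.CyclicUnitaryPowersDeckModelClauses
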